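import Summits.QuantumFields.GaugeBoot.ZdLoopEquationStates
import Summits.QuantumFields.GaugeBoot.StrongCouplingOneStep
import HarnessLib

/-!
# Strong coupling from the loop equation, VIII: the first-order bound for EVERY infinite-volume DLR state (gauge-boot, ADDENDUM 22 part H)

HONEST FRAMING (cell `pub-gaugeboot`, page 1 of every file): the venture produces certified bounds
on lattice expectations at stated coupling, gauge group, dimension and torus size; NOT a mass gap,
NOT a continuum limit, NOT a string tension; NOT Yang–Mills-summit-bearing (barriers
`FixedCouplingUltralocality`, `PerturbativeInvisibility`).  An analytic STRONG-COUPLING bound with an explicit constant for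
every one-link Gibbs (DLR) state on `ℤ^d`, at every real coupling; informative only for small `|β_std|`.

## Content (`SU(N)`, `N ≥ 2`, fundamental representation, `ℤ^d`, `d ≥ 2`, every real tree coupling `β = β_std/N`)

The single-link loop equation holds for every DLR state `μ ∈ 𝒢(β)` on `ℤ^d` (`ZdLoopEquationStates`,
`loopEquation_pairForm_suN_of_mem_ymGibbsMeasures`).  Read at the plaquette word `+a +ν −a −ν` and the link `(x, a)` — whose
occurrence sets on `ℤ^d` are `{0}` (forward) and `∅` (backward), `filter_fwdOccZ_plaquette` / `filter_bwdOccZ_plaquette` —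
it says `(1 − 1/N²)·⟨u_P⟩_μ = −(β/(2N))·Σ_{ν'≠a,ε}(w − w − (d − d))` with all loop and pair variables in `[−1, 1]`, whence

* ★★★ `abs_integral_plaquette_le_of_mem_ymGibbsMeasures` — for EVERY `μ ∈ ymGibbsMeasures (fundamentalRep (Fin N)) β`
  (no translation invariance, no reflection positivity, no limit procedure) and every plaquette `(x; a ≠ ν)` of `ℤ^d`:
  **`|∫ (1/N) Re tr U_P dμ| ≤ 4(d−1)N|β|/(N²−1)`** (`= 4(d−1)|β_std|/(N²−1)`) — at small coupling much sharper than the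
  unfreezing gap `1 − e^{−4(d−1)N|β|}` of `QuantitativeUnfreezing` (`SU(3)`, `d = 4`, `β_std = 0.1`: `0.15` versus `0.70`).

References: Yu. Makeenko, *Methods of contemporary gauge theory* (2002) §12; H.-O. Georgii, *Gibbs Measures and Phase
Transitions* (2011) Ch. 2 (DLR states).  Everything is `[folklore]`.
-/

noncomputable section

open MeasureTheory
open scoped Matrix
open Literature.Probability.LatticeModels (Site IsGibbsMeasure)
open Literature.MathematicalPhysics.QuantumLattice (LGConfig ZdEdge fundamentalRep fundamentalLatticeRep
  continuous_fundamentalRep ymGibbsMeasures ymSpecification plaquetteObs plaquetteHolonomyZd fundamentalRep_apply)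
namespace Summit.QuantumFields.GaugeBoot

namespace StrongCoupling

variable {d N : ℕ}

/-! ## The occurrence sets of the plaquette word on `ℤ^d` -/

/-- The partial displacements of the plaquette word `+a +ν −a −ν`. [folklore] -/
theorem dispZ_plaquette_two (a ν : Fin d) : (Word.plaquette a ν).dispZ 2 = Pi.single a 1 + Pi.single ν 1 := by
  simp [Word.dispZ, Word.plaquette, Step.dispZ]

/-- **Forward occurrences of `(x, a)` in `+a +ν −a −ν`: only the first letter.** [folklore] -/
theorem filter_fwdOccZ_plaquette {a ν : Fin d} (haν : a ≠ ν) :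
    (Finset.range (Word.plaquette a ν).length).filter ((Word.plaquette a ν).fwdOccZ a) = {0} := by
  ext k
  simp only [Finset.mem_filter, Finset.mem_range, Finset.mem_singleton, Word.length_plaquette]
  constructor
  · rintro ⟨hk, hocc⟩
    have h1 := hocc.1
    interval_cases k
    · rfl
    · simp [Word.plaquette, haν.symm] at h1
    · simp [Word.plaquette] at h1
    · simp [Word.plaquette] at h1
  · rintro rfl
    exact ⟨by norm_num, by simp [Word.fwdOccZ, Word.plaquette]⟩

/-- **Backward occurrences of `(x, a)` in `+a +ν −a −ν`: none** (the third letter `−a` is taken from `x + e_a + e_ν`,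
not from `x + e_a`). [folklore] -/
theorem filter_bwdOccZ_plaquette {a ν : Fin d} (haν : a ≠ ν) :
    (Finset.range (Word.plaquette a ν).length).filter ((Word.plaquette a ν).bwdOccZ a) = ∅ := by
  ext k
  simp only [Finset.mem_filter, Finset.mem_range, Finset.notMem_empty, iff_false, not_and, Word.length_plaquette]
  intro hk hocc
  have h1 := hocc.1
  interval_cases k
  · simp [Word.plaquette] at h1
  · simp [Word.plaquette] at h1
  · have h2 := congrFun hocc.2 ν
    rw [dispZ_plaquette_two] at h2
    simp [haν] at h2
  · simp [Word.plaquette, haν.symm] at h1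

/-- The plaquette word is closed on `ℤ^d`. [folklore] -/
theorem endpointZd_plaquette (x : Site d) (a ν : Fin d) : Word.endpointZd x (Word.plaquette a ν) = x := by
  simp [Word.plaquette]
  abel

/-! ## The first-order bound for every DLR state -/

/-- `‖tr ρ(g)‖ ≤ N` in the fundamental representation of `SU(N)`. [folklore] -/
theorem norm_trace_fundamentalRep_le' (g : Matrix.specialUnitaryGroup (Fin N) ℂ) : ‖(fundamentalRep (Fin N) g).trace‖ ≤ N :=
  norm_trace_le (fundamentalLatticeRep N) g

/-- `‖∫ tr ρ(hol w) dμ‖ ≤ N` for a probability measure on `ℤ^d` configurations. [folklore] -/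
theorem norm_integral_trace_wordHolonomyZd_le (μ : Measure (LGConfig d (Matrix.specialUnitaryGroup (Fin N) ℂ)))
    [IsProbabilityMeasure μ] (x : Site d) (w : Word d) :
    ‖∫ U, (fundamentalRep (Fin N) (wordHolonomyZd U x w)).trace ∂μ‖ ≤ N := by
  have h := norm_integral_le_of_norm_le_const (μ := μ) (ae_of_all _ fun U => norm_trace_fundamentalRep_le' (N := N)
    (wordHolonomyZd U x w))
  rwa [probReal_univ, mul_one] at h

/-- `‖∫ tr ρ(hol v) · tr ρ(hol w) dμ‖ ≤ N²` for a probability measure. [folklore] -/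
theorem norm_integral_trace_mul_trace_wordHolonomyZd_le (μ : Measure (LGConfig d (Matrix.specialUnitaryGroup (Fin N) ℂ)))
    [IsProbabilityMeasure μ] (x : Site d) (v w : Word d) :
    ‖∫ U, (fundamentalRep (Fin N) (wordHolonomyZd U x v)).trace * (fundamentalRep (Fin N) (wordHolonomyZd U x w)).trace ∂μ‖ ≤
      (N : ℝ) ^ 2 := by
  have hb : ∀ U : LGConfig d (Matrix.specialUnitaryGroup (Fin N) ℂ),
      ‖(fundamentalRep (Fin N) (wordHolonomyZd U x v)).trace * (fundamentalRep (Fin N) (wordHolonomyZd U x w)).trace‖ ≤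
        (N : ℝ) ^ 2 := fun U => by
    rw [norm_mul, sq]
    exact mul_le_mul (norm_trace_fundamentalRep_le' (N := N) (wordHolonomyZd U x v))
      (norm_trace_fundamentalRep_le' (N := N) (wordHolonomyZd U x w)) (norm_nonneg _) (Nat.cast_nonneg N)
  have h := norm_integral_le_of_norm_le_const (μ := μ) (ae_of_all _ hb)
  rwa [probReal_univ, mul_one] at h

/-- The complex trace of a word holonomy is measurable on `ℤ^d` configurations. [folklore] -/
theorem measurable_trace_wordHolonomyZd (x : Site d) (w : Word d) :
    Measurable fun U : LGConfig d (Matrix.specialUnitaryGroup (Fin N) ℂ) => (fundamentalRep (Fin N) (wordHolonomyZd U x w)).trace := by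
  have hf := entryMeasurable_wordHolonomyZd (fundamentalRep (Fin N)) (continuous_fundamentalRep (Fin N)) w x
  simp only [Matrix.trace, Matrix.diag_apply]
  exact Finset.measurable_sum _ fun k _ => hf k k

/-- ★★★ **THE PLAQUETTE OF EVERY DLR STATE AT STRONG COUPLING, FIRST ORDER.**  For `SU(N)`, `N ≥ 2`, `d ≥ 2`, EVERY real
(tree) coupling `β`, EVERY infinite-volume DLR state `μ ∈ 𝒢(β)` on `ℤ^d` and every plaquette `(x; a ≠ ν)`:
`|∫ (1/N) Re tr U_P dμ| ≤ 4(d−1)N|β|/(N²−1)` — one loop-equation step, no symmetry and no limit procedure assumed.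
[folklore] -/
theorem abs_integral_plaquette_le_of_mem_ymGibbsMeasures (hN : 2 ≤ N) {β : ℝ}
    {μ : Measure (LGConfig d (Matrix.specialUnitaryGroup (Fin N) ℂ))} (hμ : μ ∈ ymGibbsMeasures (fundamentalRep (Fin N)) β)
    (x : Site d) {a ν : Fin d} (haν : a ≠ ν) :
    |∫ U, (N : ℝ)⁻¹ * plaquetteObs (fundamentalRep (Fin N)) x a ν U ∂μ| ≤ 4 * ((d : ℝ) - 1) * N * |β| / ((N : ℝ) ^ 2 - 1) := by
  haveI : SecondCountableTopology (Matrix (Fin N) (Fin N) ℂ) :=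
    inferInstanceAs (SecondCountableTopology (Fin N → Fin N → ℂ))
  haveI : SecondCountableTopology (Matrix.specialUnitaryGroup (Fin N) ℂ) :=
    Topology.IsEmbedding.subtypeVal.secondCountableTopology
  have hG : IsGibbsMeasure (ymSpecification (fundamentalRep (Fin N)) β) μ := hμ
  haveI := hG.isProbabilityMeasure
  have hN0 : N ≠ 0 := by omega
  have hNpos : (0 : ℝ) < N := by exact_mod_cast Nat.pos_of_ne_zero hN0
  have hN21 : (0 : ℝ) < (N : ℝ) ^ 2 - 1 := by
    have : (2 : ℝ) ≤ N := by exact_mod_cast hN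
    nlinarith
  -- the loop equation at the plaquette word
  have h := loopEquation_pairForm_suN_of_mem_ymGibbsMeasures hμ x a (Word.plaquette a ν) (endpointZd_plaquette x a ν)
  rw [filter_fwdOccZ_plaquette haν, filter_bwdOccZ_plaquette haν, Finset.sum_singleton, Finset.sum_empty, sub_zero] at h
  simp only [List.take_zero, List.drop_zero, wordHolonomyZd_nil, map_one, Matrix.trace_one, Fintype.card_fin] at h
  -- abbreviations
  set T : ℂ := ∫ U, (fundamentalRep (Fin N) (wordHolonomyZd U x (Word.plaquette a ν))).trace ∂μ with hT
  have hTN : ∫ U, (N : ℂ) * (fundamentalRep (Fin N) (wordHolonomyZd U x (Word.plaquette a ν))).trace ∂μ = (N : ℂ) * T := by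
    rw [hT, ← integral_const_mul]
  rw [hTN] at h
  -- the plaquette sum is bounded by `2(d−1)·4`
  set S := ∑ ν' ∈ Finset.univ.erase a, ∑ ε : Bool,
    ((N : ℝ)⁻¹ * (∫ U, (fundamentalRep (Fin N) (wordHolonomyZd U x (Word.plaquette a ν ++ plaqWord a ν' ε))).trace ∂μ).re -
      (N : ℝ)⁻¹ * (∫ U, (fundamentalRep (Fin N)
        (wordHolonomyZd U x (Word.plaquette a ν ++ (plaqWord a ν' ε).reverse))).trace ∂μ).re -
      ((∫ U, (fundamentalRep (Fin N) (wordHolonomyZd U x (Word.plaquette a ν))).trace *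
            (fundamentalRep (Fin N) (wordHolonomyZd U x (plaqWord a ν' ε))).trace ∂μ).re / (N : ℝ) ^ 2 -
        (∫ U, (fundamentalRep (Fin N) (wordHolonomyZd U x (Word.plaquette a ν))).trace *
            (fundamentalRep (Fin N) (wordHolonomyZd U x (plaqWord a ν' ε).reverse)).trace ∂μ).re / (N : ℝ) ^ 2)) with hS
  have hw : ∀ w : Word d, |(N : ℝ)⁻¹ * (∫ U, (fundamentalRep (Fin N) (wordHolonomyZd U x w)).trace ∂μ).re| ≤ 1 := fun w => by
    rw [abs_mul, abs_inv, Nat.abs_cast]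
    have h1 := (Complex.abs_re_le_norm _).trans (norm_integral_trace_wordHolonomyZd_le μ x w)
    calc (N : ℝ)⁻¹ * |(∫ U, (fundamentalRep (Fin N) (wordHolonomyZd U x w)).trace ∂μ).re| ≤ (N : ℝ)⁻¹ * N := by gcongr
      _ = 1 := inv_mul_cancel₀ hNpos.ne'
  have hp : ∀ v w : Word d, |(∫ U, (fundamentalRep (Fin N) (wordHolonomyZd U x v)).trace *
      (fundamentalRep (Fin N) (wordHolonomyZd U x w)).trace ∂μ).re / (N : ℝ) ^ 2| ≤ 1 := fun v w => by
    rw [abs_div, abs_of_pos (by positivity : (0 : ℝ) < (N : ℝ) ^ 2), div_le_one (by positivity)]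
    exact (Complex.abs_re_le_norm _).trans (norm_integral_trace_mul_trace_wordHolonomyZd_le μ x v w)
  have hSle : |S| ≤ ((d : ℝ) - 1) * (2 * 4) := by
    rw [hS]
    refine (Finset.abs_sum_le_sum_abs _ _).trans ?_
    have hterm : ∀ ν' ∈ Finset.univ.erase a, |∑ ε : Bool,
        ((N : ℝ)⁻¹ * (∫ U, (fundamentalRep (Fin N) (wordHolonomyZd U x (Word.plaquette a ν ++ plaqWord a ν' ε))).trace ∂μ).re -
          (N : ℝ)⁻¹ * (∫ U, (fundamentalRep (Fin N)
            (wordHolonomyZd U x (Word.plaquette a ν ++ (plaqWord a ν' ε).reverse))).trace ∂μ).re -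
          ((∫ U, (fundamentalRep (Fin N) (wordHolonomyZd U x (Word.plaquette a ν))).trace *
                (fundamentalRep (Fin N) (wordHolonomyZd U x (plaqWord a ν' ε))).trace ∂μ).re / (N : ℝ) ^ 2 -
            (∫ U, (fundamentalRep (Fin N) (wordHolonomyZd U x (Word.plaquette a ν))).trace *
                (fundamentalRep (Fin N) (wordHolonomyZd U x (plaqWord a ν' ε).reverse)).trace ∂μ).re / (N : ℝ) ^ 2))| ≤
        2 * 4 := fun ν' _ => by
      refine (Finset.abs_sum_le_sum_abs _ _).trans ?_
      have h4 : ∀ ε : Bool, |(N : ℝ)⁻¹ * (∫ U, (fundamentalRep (Fin N)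
          (wordHolonomyZd U x (Word.plaquette a ν ++ plaqWord a ν' ε))).trace ∂μ).re -
          (N : ℝ)⁻¹ * (∫ U, (fundamentalRep (Fin N)
            (wordHolonomyZd U x (Word.plaquette a ν ++ (plaqWord a ν' ε).reverse))).trace ∂μ).re -
          ((∫ U, (fundamentalRep (Fin N) (wordHolonomyZd U x (Word.plaquette a ν))).trace *
                (fundamentalRep (Fin N) (wordHolonomyZd U x (plaqWord a ν' ε))).trace ∂μ).re / (N : ℝ) ^ 2 -
            (∫ U, (fundamentalRep (Fin N) (wordHolonomyZd U x (Word.plaquette a ν))).trace *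
                (fundamentalRep (Fin N) (wordHolonomyZd U x (plaqWord a ν' ε).reverse)).trace ∂μ).re / (N : ℝ) ^ 2)| ≤
          4 := fun ε => by
        have e1 := hw (Word.plaquette a ν ++ plaqWord a ν' ε)
        have e2 := hw (Word.plaquette a ν ++ (plaqWord a ν' ε).reverse)
        have e3 := hp (Word.plaquette a ν) (plaqWord a ν' ε)
        have e4 := hp (Word.plaquette a ν) (plaqWord a ν' ε).reverse
        rw [abs_le] at e1 e2 e3 e4 ⊢
        constructor <;> linarith [e1.1, e1.2, e2.1, e2.2, e3.1, e3.2, e4.1, e4.2]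
      calc _ ≤ ∑ _ε : Bool, (4 : ℝ) := Finset.sum_le_sum fun ε _ => h4 ε
        _ = 2 * 4 := by simp [two_mul]
    calc _ ≤ ∑ _ν' ∈ Finset.univ.erase a, (2 * 4 : ℝ) := Finset.sum_le_sum hterm
      _ = ((d : ℝ) - 1) * (2 * 4) := by rw [Finset.sum_const, nsmul_eq_mul, card_univ_erase_real]
  -- the equation: `(N T).re/N² − N⁻¹ T.re/N² + (β/(2N)) S = 0`, i.e. `T.re (N² − 1)/N³ = −(β/(2N)) S`
  have heq : ((N : ℂ) * T).re / (N : ℝ) ^ 2 - (N : ℝ)⁻¹ * T.re / (N : ℝ) ^ 2 + β / (2 * N) * S = 0 := h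
  have hre : ((N : ℂ) * T).re = N * T.re := by simp [Complex.mul_re]
  rw [hre] at heq
  have hTre : T.re * ((N : ℝ) ^ 2 - 1) = -(β / 2) * (N : ℝ) ^ 2 * S := by
    have key : ((N : ℝ) * T.re / (N : ℝ) ^ 2 - (N : ℝ)⁻¹ * T.re / (N : ℝ) ^ 2 + β / (2 * N) * S) * (N : ℝ) ^ 3 =
        T.re * ((N : ℝ) ^ 2 - 1) + β / 2 * (N : ℝ) ^ 2 * S := by
      field_simp
    rw [heq, zero_mul] at key
    linarith
  -- the plaquette expectation is `T.re / N`
  have hi : Integrable (fun U : LGConfig d (Matrix.specialUnitaryGroup (Fin N) ℂ) =>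
      (fundamentalRep (Fin N) (wordHolonomyZd U x (Word.plaquette a ν))).trace) μ :=
    Integrable.of_bound (measurable_trace_wordHolonomyZd x _).aestronglyMeasurable N
      (ae_of_all _ fun U => norm_trace_fundamentalRep_le' _)
  have hu : ∫ U, (N : ℝ)⁻¹ * plaquetteObs (fundamentalRep (Fin N)) x a ν U ∂μ = (N : ℝ)⁻¹ * T.re := by
    have h1 := integral_re hi
    simp only [RCLike.re_to_complex] at h1
    rw [integral_const_mul, hT, ← h1]
    congr 1
    refine integral_congr_ae (ae_of_all _ fun U => ?_)
    simp only [plaquetteObs, wordHolonomyZd_plaquette]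
  rw [hu, abs_mul, abs_inv, Nat.abs_cast]
  -- `|T.re| (N² − 1) ≤ (|β|/2) N² · 8(d−1)`
  have hd1 : (0 : ℝ) ≤ (d : ℝ) - 1 := by
    have : (1 : ℝ) ≤ d := by exact_mod_cast (Fin.pos a)
    linarith
  have hT1 : |T.re| * ((N : ℝ) ^ 2 - 1) ≤ |β| / 2 * (N : ℝ) ^ 2 * (((d : ℝ) - 1) * (2 * 4)) := by
    have := congrArg (fun t : ℝ => |t|) hTre
    simp only [abs_mul, abs_neg, abs_of_pos hN21, abs_div, abs_two, abs_pow, Nat.abs_cast] at this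
    rw [this]
    exact mul_le_mul_of_nonneg_left hSle (by positivity)
  rw [le_div_iff₀ hN21]
  calc (N : ℝ)⁻¹ * |T.re| * ((N : ℝ) ^ 2 - 1) = (N : ℝ)⁻¹ * (|T.re| * ((N : ℝ) ^ 2 - 1)) := by ring
    _ ≤ (N : ℝ)⁻¹ * (|β| / 2 * (N : ℝ) ^ 2 * (((d : ℝ) - 1) * (2 * 4))) :=
        mul_le_mul_of_nonneg_left hT1 (inv_nonneg.2 hNpos.le)
    _ = 4 * ((d : ℝ) - 1) * N * |β| := by field_simp

end StrongCoupling

end Summit.QuantumFields.GaugeBoot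

end
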